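import Summits.NavierStokesRegularity.NavierStokesRegularity.Theses.PumpContinuation
import Literature.Analysis.FluidPDE.SelfSimilarLiouville
import Literature.Analysis.FluidPDE.TaoAveragedSobolevSymmetry
import Mathlib.Dynamics.Circle.RotationNumber.TranslationNumber
import Mathlib.Analysis.Calculus.InverseFunctionTheorem.ApproximatesLinearOn
import Mathlib.Analysis.Calculus.MeanValue

/-!
# Sketch (crux-ideate, round 2, ideator 5) for crux `EulerProximatePump`
(stmt-NavierStokesRegularity-18302) — idea card `tongue-door`

Typed first statements of the line "Arnold-tongue Door": a quasi-periodic (phase-DSS) Type-I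
hull of TRUE Navier–Stokes, which carries no (rotated) DSS profile and so feeds none of the
in-tree bridges, is PHASE-LOCKED into exactly (rotated-)DSS Type-I profiles of the nearby
scale-invariant averaged equations `∂ₜu = Δu + (B + η B̃_𝒜)(u,u)` for a sequence `η ↓ 0`
(one parameter closes one neutral direction), and those are ignited by the tree's autonomous
RDSS truncation machinery; the landed accumulation normal form then gives the Door.

Contents (everything here elaborates; the two abstract lemmas L1, L2 are PROVED from Mathlib):
* §1 the NS-side input `TypeIPhaseHull` typed over `IsAncientMildSolution`, `HasTypeIDecay`,
  `IsRotatedDSS`; its rational-phase case is the dominated RDSS case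
  (`isRotatedDSS_of_phase_zero`, `typeIPhaseHull_of_not_rotatedLiouville`).
* §2 L1 `lock_of_moving_translationNumber`: a moving rotation number takes rational values for
  parameters accumulating at `0⁺`, and rational rotation number = a periodic orbit (Poincaré).
* §3 L2 `parametricClosing`: bordered Graves/Newton — one real parameter closes a near-return
  with one neutral direction when defect · (bordered right inverse) is small (the first lemma of
  the card).
* §4 the admissible perturbation directions: multiplier-free data, polarised cancellation law.
-/

noncomputable section

set_option linter.dupNamespace false
set_option linter.unusedVariables false

open MeasureTheory Set Filter Metric
open scoped ENNReal NNReal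
open Literature.Analysis.FluidPDE Literature.Analysis.FluidPDE.Tao2016
open Summit.NavierStokesRegularity.NavierStokesRegularity.Theses.PumpContinuation

namespace Summit.NavierStokesRegularity.NavierStokesRegularity.Cruxes.EulerProximatePump.Ideas.TongueDoor

local notation "ℝ³" => EuclideanSpace ℝ (Fin 3)

/-! ## §1 The NS-side input: a phase-(R)DSS Type-I hull -/

/-- A **phase-(rotated-)DSS hull**: a `1`-periodic circle `φ ↦ U φ` of fields such that the
Navier–Stokes rescaling by `c` (twisted by the isometry `R`) maps the slice at phase `φ + α` onto
the slice at phase `φ`: `c • R⁻¹ (U (φ+α)) (c²t) (c R x) = U φ t x`. For `α ∈ ℤ` every `U φ` is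
rotated-DSS (`isRotatedDSS_of_phase_zero`); for irrational `α` and a non-constant circle this is a
QUASI-PERIODICALLY self-similar object (two frequencies in logarithmic time) containing no DSS
element: an invariant circle of the renormalisation map with irrational rotation number. -/
def IsPhaseRdssHull (c α : ℝ) (R : ℝ³ ≃ₗᵢ[ℝ] ℝ³) (U : ℝ → ℝ → ℝ³ → ℝ³) : Prop :=
  (∀ φ, U (φ + 1) = U φ) ∧ ∀ φ t x, c • R.symm (U (φ + α) (c ^ 2 * t) (c • R x)) = U φ t x

/-- **(T) A Type-I phase hull exists** — the NS-hard input of the line: some factor `c > 1`,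
phase shift `α`, isometry `R` and a phase hull of ancient mild solutions (`ν = 1`) with a common
Type-I decay constant, not all trivial. It is IMPLIED by the failure of the rotated Type-I DSS
Liouville statement (`typeIPhaseHull_of_not_rotatedLiouville`: constant hull, `α = 0`) — the
dominated case — and its new case is `α ∉ ℚ` with a non-constant circle, for which no theorem in
the tree or in print produces a blow-up of true NS from Schwartz data. -/
def TypeIPhaseHull : Prop :=
  ∃ (c α C₀ : ℝ) (R : ℝ³ ≃ₗᵢ[ℝ] ℝ³) (U : ℝ → ℝ → ℝ³ → ℝ³), 1 < c ∧ IsPhaseRdssHull c α R U ∧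
    (∀ φ, IsAncientMildSolution 1 (U φ) ∧ (∀ t < 0, AEStronglyMeasurable (U φ t) volume) ∧
      HasTypeIDecay C₀ (U φ)) ∧
    ∃ φ, ¬ ∀ t < 0, U φ t =ᵐ[volume] 0

/-- Integer (here: zero) phase shift is the rotated-DSS case. [folklore] -/
theorem isRotatedDSS_of_phase_zero {c : ℝ} {R : ℝ³ ≃ₗᵢ[ℝ] ℝ³} {U : ℝ → ℝ → ℝ³ → ℝ³}
    (h : IsPhaseRdssHull c 0 R U) (φ : ℝ) : IsRotatedDSS c R (U φ) := by
  intro t x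
  simpa using h.2 φ t x

/-- The dominated case sits inside (T): a counterexample to the rotated Type-I DSS Liouville
statement is a constant phase hull with zero phase shift. [folklore] -/
theorem typeIPhaseHull_of_not_rotatedLiouville {c : ℝ} {R : ℝ³ ≃ₗᵢ[ℝ] ℝ³} (hc : 1 < c)
    (h : ¬ RotatedTypeIDSSLiouville c R) : TypeIPhaseHull := by
  by_contra hT
  apply h
  intro _ u hu hmeas hdss hdec
  obtain ⟨C₀, hC₀⟩ := hdec
  by_contra hnot
  exact hT ⟨c, 0, C₀, R, fun _ => u, hc, ⟨fun _ => rfl, fun _ t x => by simpa using hdss t x⟩,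
    fun _ => ⟨hu, hmeas, hC₀⟩, 0, hnot⟩

/-! ## §2 L1 — a moving rotation number locks at rationals accumulating at `0⁺` -/

/-- **Locking lemma (uniform branch).** If a family of circle maps (lifts) has continuous maps,
a rotation number continuous in the parameter on every `[0, η₀]`, and not locally constant at
`0⁺`, then for parameters `η > 0` accumulating at `0` the map `f η` has a periodic orbit
(`(f η)^n x = x + m`): rationals are dense, IVT, and Poincaré's "rational rotation number ⇔
periodic orbit" (`CircleDeg1Lift.translationNumber_eq_rat_iff`). In the line, `f η` is the
renormalisation map of `B + η B̃_𝒜` restricted to the persisting invariant circle, and a periodic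
orbit of it is an exactly rotated-DSS Type-I profile of the perturbed equation. [folklore] -/
theorem lock_of_moving_translationNumber (f : ℝ → CircleDeg1Lift)
    (hc : ∀ η, Continuous ⇑(f η))
    (hτ : ∀ η₀, 0 < η₀ → ContinuousOn (fun η => (f η).translationNumber) (Icc 0 η₀))
    (hmove : ∀ η₀, 0 < η₀ → ∃ η ∈ Ioo 0 η₀, (f η).translationNumber ≠ (f 0).translationNumber) :
    ∀ η₀, 0 < η₀ → ∃ η ∈ Ioo 0 η₀, ∃ n : ℕ, 0 < n ∧ ∃ m : ℤ, ∃ x : ℝ, ((f η) ^ n) x = x + m := by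
  intro η₀ hη₀
  obtain ⟨η₁, hη₁, hne⟩ := hmove η₀ hη₀
  set τ : ℝ → ℝ := fun η => (f η).translationNumber with hτdef
  have hcont : ContinuousOn τ (Icc 0 η₁) := hτ η₁ hη₁.1
  -- a rational value strictly between τ 0 and τ η₁ is attained at some η ∈ (0, η₁]
  have key : ∃ q : ℚ, (q : ℝ) ≠ τ 0 ∧ ∃ η ∈ Icc 0 η₁, τ η = q := by
    rcases lt_or_gt_of_ne hne with hlt | hgt
    · -- τ η₁ < τ 0
      obtain ⟨q, hq₁, hq₂⟩ := exists_rat_btwn hlt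
      have himg : Icc (τ η₁) (τ 0) ⊆ τ '' Icc 0 η₁ := intermediate_value_Icc' hη₁.1.le hcont
      obtain ⟨η, hη, hηq⟩ := himg ⟨hq₁.le, hq₂.le⟩
      exact ⟨q, ne_of_lt hq₂, η, hη, hηq⟩
    · -- τ 0 < τ η₁
      obtain ⟨q, hq₁, hq₂⟩ := exists_rat_btwn hgt
      have himg : Icc (τ 0) (τ η₁) ⊆ τ '' Icc 0 η₁ := intermediate_value_Icc hη₁.1.le hcont
      obtain ⟨η, hη, hηq⟩ := himg ⟨hq₁.le, hq₂.le⟩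
      exact ⟨q, ne_of_gt hq₁, η, hη, hηq⟩
  obtain ⟨q, hq0, η, hη, hηq⟩ := key
  have hηpos : 0 < η := by
    rcases hη.1.eq_or_lt with h0 | h0
    · exact absurd (h0 ▸ hηq).symm hq0
    · exact h0
  refine ⟨η, ⟨hηpos, hη.2.trans_lt hη₁.2⟩, q.den, q.pos, q.num, ?_⟩
  have hrat : (f η).translationNumber = (q.num : ℝ) / (q.den : ℝ) := by
    have : τ η = (q : ℝ) := hηq
    rw [hτdef] at this
    simp only at this
    rw [this, Rat.cast_def]
  exact ((f η).translationNumber_eq_rat_iff (hc η) q.pos).1 hrat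

/-! ## §3 L2 — parametric closing (bordered Graves): the first lemma of the card -/

/-- **Parametric closing of a near-return (one parameter, one neutral direction).**
`G : ℝ × E → E` is the parametrised return map (`G (η, x) = 𝓡_{c,η}^{q}(x)`: `q` renormalisation
periods of the equation perturbed by `η B̃_𝒜`), `x₀` a point of the NS hull whose `q`-th return has
DEFECT `‖G(0,x₀) − x₀‖ ≤ r/(2K)` (Liouville near-return: `‖qα‖` small), the BORDERED linearisation
`(s, ξ) ↦ ∂_η G · s + (D_x G − 1) ξ` at `(0, x₀)` has a bounded right inverse of norm `≤ K`
(the normal resolvent of the monodromy, and the parameter `η` absorbing the neutral phase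
direction — this is where `𝒜` must MOVE the phase: nonzero mean first variation), and the
derivative oscillates by `≤ 1/(4K)` on the ball. Then the perturbed equation has an EXACT periodic
point (`G z = z.2`, i.e. a rotated-DSS profile of `B + z.1 • B̃_𝒜`) within `r` of `(0, x₀)`.
Quantitative surjectivity (`ApproximatesLinearOn.surjOn_closedBall_of_nonlinearRightInverse`)
applied to `H z = G z − z.2`. [folklore] -/
theorem parametricClosing {E : Type*} [NormedAddCommGroup E] [NormedSpace ℝ E] [CompleteSpace E]
    (G : ℝ × E → E) (G' : ℝ × E → (ℝ × E →L[ℝ] E)) (x₀ : E) {r K : ℝ} (hr : 0 < r) (hK : 0 < K)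
    (hG : ∀ z ∈ closedBall ((0 : ℝ), x₀) r, HasFDerivAt G (G' z) z)
    (hosc : ∀ z ∈ closedBall ((0 : ℝ), x₀) r, ‖G' z - G' (0, x₀)‖ ≤ 1 / (4 * K))
    (Ψ : E →L[ℝ] ℝ × E)
    (hΨinv : ∀ y, (G' (0, x₀) - ContinuousLinearMap.snd ℝ ℝ E) (Ψ y) = y)
    (hΨK : ∀ y, ‖Ψ y‖ ≤ K * ‖y‖)
    (hdef : ‖G (0, x₀) - x₀‖ ≤ r / (2 * K)) :
    ∃ z ∈ closedBall ((0 : ℝ), x₀) r, G z = z.2 := by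
  set z₀ : ℝ × E := ((0 : ℝ), x₀) with hz₀
  set H : ℝ × E → E := fun z => G z - z.2 with hH
  set H' : ℝ × E → (ℝ × E →L[ℝ] E) := fun z => G' z - ContinuousLinearMap.snd ℝ ℝ E with hH'
  have hHd : ∀ z ∈ closedBall z₀ r, HasFDerivWithinAt H (H' z) (closedBall z₀ r) z := fun z hz =>
    ((hG z hz).sub (ContinuousLinearMap.snd ℝ ℝ E).hasFDerivAt).hasFDerivWithinAt
  have hbound : ∀ z ∈ closedBall z₀ r, ‖H' z - H' z₀‖ ≤ 1 / (4 * K) :=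
    fun z hz => by
      have : H' z - H' z₀ = G' z - G' z₀ := by simp only [hH']; abel
      rw [this]; exact hosc z hz
  have happ : ApproximatesLinearOn H (H' z₀) (closedBall z₀ r) ⟨1 / (4 * K), by positivity⟩ := by
    intro x hx y hy
    exact (convex_closedBall z₀ r).norm_image_sub_le_of_norm_hasFDerivWithin_le' hHd hbound hy hx
  let Φ : (H' z₀).NonlinearRightInverse :=
    { toFun := Ψ
      nnnorm := ⟨K, hK.le⟩
      bound' := fun y => hΨK y
      right_inv' := fun y => by simpa [hH'] using hΨinv y }
  have hsurj := happ.surjOn_closedBall_of_nonlinearRightInverse Φ hr.le Subset.rfl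
  have hrad : (((Φ.nnnorm : ℝ)⁻¹ - ((⟨1 / (4 * K), by positivity⟩ : ℝ≥0) : ℝ)) * r) = 3 * r / (4 * K) := by
    show ((K⁻¹ - 1 / (4 * K)) * r) = 3 * r / (4 * K)
    field_simp
    ring
  have hmem : (0 : E) ∈ closedBall (H z₀) (((Φ.nnnorm : ℝ)⁻¹ - ((⟨1 / (4 * K), by positivity⟩ : ℝ≥0) : ℝ)) * r) := by
    rw [hrad, mem_closedBall, dist_comm, dist_zero_right]
    calc ‖H z₀‖ = ‖G (0, x₀) - x₀‖ := rfl
      _ ≤ r / (2 * K) := hdef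
      _ ≤ 3 * r / (4 * K) := by
        rw [div_le_div_iff₀ (by positivity) (by positivity)]
        nlinarith
  obtain ⟨z, hz, hHz⟩ := hsurj hmem
  exact ⟨z, hz, sub_eq_zero.1 hHz⟩

/-! ## §4 The admissible perturbation directions -/

/-- **Multiplier-free averaging data**: every random symbol is a real constant (slots
`c · Rot_R · Dil_λ` only). Their forms commute EXACTLY with the Navier–Stokes scaling and act
boundedly on the sup-norm phase space of the in-tree RDSS bridge (no `m(D)` on `C₀`), so
`B + η B̃_𝒜` has an autonomous similarity flow and exact renormalisation maps. -/
def IsMultiplierFree (𝒜 : AveragingDatum) : Prop :=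
  ∀ i θ, ∃ a : ℝ, ∀ ξ, 𝒜.m i θ ξ = (a : ℂ)

/-- **(P1) Polarised cancellation law** (support, to be proved by the relabelling argument of
`integral_Λ_self_eq_zero` with three different fields): the CYCLIC sum of the Euler trilinear form
over three `H¹⁰_df` fields vanishes. Consequence: the cyclic symmetrisation of ANY averaging datum
has Tao's cancellation property, and composed with the in-tree coin symmetrisation
(`AveragingDatum.symmetrize`) every slot dressing yields a symmetric cancelling datum — the
admissible directions of the Door form a rich cone containing multiplier-free, scale-invariant
members other than multiples of `B`. -/
def PolarisedCancellation : Prop :=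
  ∀ a b c : L2C, MemH10df a → MemH10df b → MemH10df c →
    eulerForm a b c + eulerForm b c a + eulerForm c a b = 0

/-- **(P1') Cyclic symmetrisation** (support): every datum has a cyclically symmetrised companion
with the cancellation property, multiplier-free if the datum is. -/
def CyclicSymmetrisation : Prop :=
  ∀ 𝒜 : AveragingDatum, ∃ 𝒜' : AveragingDatum,
    (∀ u v w, MemH10df u → MemH10df v → MemH10df w →
      𝒜'.form u v w = (𝒜.form u v w + 𝒜.form v w u + 𝒜.form w u v) / 3) ∧
    𝒜'.HasCancellation ∧ (IsMultiplierFree 𝒜 → IsMultiplierFree 𝒜')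

/-- **The line's output feeding the landed normal form.** Blow-up parameters accumulating at
`0⁺` for the perturbed forms `B + η B̃_𝒜` at one ceiling (the hypothesis of the landed
`stub_doorOfAccumulating`, p146213/p146216); the tongue line produces it from (T) + locking +
the perturbed RDSS bridge. Copied shape of `Disproof.TypeIBlowupFor`. -/
def TypeIBlowupFor (T : L2C → L2C → L2C → ℂ) (M : ℝ) : Prop :=
  ∃ u₀ : SchwartzMap ℝ³ ℝ³, VectorCalculus.IsDivFree ⇑u₀ ∧ ∃ S : ℝ, 0 < S ∧ ∃ u : ℝ → L2C,
    IsMildSolutionFor T (schwartzL2 u₀) (Ico 0 S) u ∧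
    (∀ t ∈ Ico 0 S, eLpNorm (u t) ⊤ volume ≤ ENNReal.ofReal (M / Real.sqrt (S - t))) ∧
    ¬ ∃ S' : ℝ, S < S' ∧ ∃ v : ℝ → L2C,
      IsMildSolutionFor T (schwartzL2 u₀) (Ico 0 S') v ∧ ∀ t ∈ Ico 0 S, v t = u t

/-- The perturbed form `B + η B̃_𝒜`. -/
def pertForm (𝒜 : AveragingDatum) (η : ℝ) : L2C → L2C → L2C → ℂ :=
  fun a b c => eulerForm a b c + ((η : ℝ) : ℂ) * 𝒜.form a b c

/-- **Locked family** — the conclusion of the tongue mechanism for one multiplier-free symmetric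
cancelling datum: Type-I blow-ups of `B + η B̃_𝒜` at one ceiling for `η ↓ 0`. -/
def LockedFamily (𝒜 : AveragingDatum) (M : ℝ) : Prop :=
  ∀ η₀ : ℝ, 0 < η₀ → ∃ η ∈ Ioo 0 η₀, TypeIBlowupFor (pertForm 𝒜 η) M

end Summit.NavierStokesRegularity.NavierStokesRegularity.Cruxes.EulerProximatePump.Ideas.TongueDoor
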